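import Summits.BirchSwinnertonDyer.BirchSwinnertonDyer.Theorems.ManinLocalTwoThreeShimuraClassThree
import HarnessLib

/-!
# C3 `ManinPrimeToThreeAtNine` helper (es g45, T-es-103, part 2 of 3: §3 the integral lift; §1–§2 = `…ShimuraClassThree`, §4–§6 = `…ShimuraClassThreeDescent`) — THE `3`-PRIMARY SHIMURA CLASS AT THE ADDITIVE LEVEL `27`:
# `3 ∣ [Λ(f) : Λ₁(f)]` and `¬ ShimuraIndexPrimeTo 3 f` for every non-zero `f ∈ S₂(Γ₀(27))`, FACT-FREE

HONEST FRAMING. Printed mathematics (Ling–Oesterlé 1991, Thm. 1: the Shimura subgroup `Σ(27)` of `J₀(27)` has order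
`3`; Mazur 1977 §II.11; Stevens 1982 Ch. 1), new formal proof. Beyond-print theorem: NO. Nothing about any elliptic
curve is asserted; the Manin conjecture `c = 1`, C2, C3 and BSD stay OPEN. This file is a NEGATIVE DATUM for the C3
domain `27 ∣ N`: the Shimura-index hypothesis `ShimuraIndexPrimeTo 3 D.f` FAILS at `N = 27` for EVERY `X₀(27)`-datum
(so no C3 closer may assume it there), in the currency of the route's own predicate.

THE OBSTACLE AND THE TRICK. The landed factorisation `exists_addMonoidHom_periodHomology_of_maninSystem` (route
ResidualThetaTransportAtTwo, fact-free) turns a left-`Γ₀(N)`-invariant MANIN SYSTEM `M` on `Γ₀(N)\SL₂(ℤ)` with values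
in `R` into an additive map `H₁(X₀(N), ℤ) = periodHomology N →+ R` — but only for `R` WITHOUT `3`-TORSION (its torsion
lemma divides by `3` once). The cubic Shimura character `χ : (ℤ/27)ˣ → (ℤ/9)ˣ → ℤ/3` (`χ = log₂ mod 3`, `chi27`)
lives in `R = ℤ/3`. We therefore LIFT: the `ℤ/3`-valued Shimura Manin system `MS_χ(h) = F_χ(h) − F_χ(hS)` of the
cusp function `F_χ` (`cuspFun`; `colFun (a, c) = ψ(c)` off the fibre `9 ∣ c`, `−χ(a)` on it, `ψ(c) = χ(c)` for units,
`χ(c/3)` for `3 ∥ c`) admits an INTEGRAL LIFT `M̃ : Γ₀(27)\SL₂(ℤ) → ℤ` (`rowFun`, two explicit tables `liftA`, `liftB`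
on `P¹(ℤ/27)` with values in `{−2,…,2}`, found by integer elimination on Manin's `18` two-term and `12` three-term
relations at level `27`) that satisfies the two- and three-term relations OVER `ℤ` (`rowFun_S`, `rowFun_three_term`,
kernel-checked by `decide` on `(ℤ/27)²`) and reduces to `MS_χ` mod `3` (`maninInt_cast`). Apply the landed theorem
with `R = ℤ` (no `3`-torsion; `S`- and `TS`-fixed cosets are handled by `2M̃ = 0 ⇒ M̃ = 0`, `3M̃ = 0 ⇒ M̃ = 0` in `ℤ`),
compose with `ℤ → ℤ/3`, and identify the chain sums with the telescoping sums of `F_χ`: the result is the cubic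
SHIMURA COVERING CLASS `φ : periodHomology 27 →+ ℤ/3`, `φ({∞, k∞}) = χ(d_k)` (`exists_shimuraHom_twentySeven`).
Since `dim S₂(Γ₀(27)) = 1` (`finrank_cuspForm_two_eq_genusX0_twentySeven`, a theorem), `φ` descends to `Λ(f)` for
every `f ≠ 0`, kills `Λ₁(f)`, and is `χ(2) = 1 ≠ 0` on `{∞, γ₂∞}_f`, `γ₂ = (14 1; 27 2)`:
`n·{∞, γ₂∞}_f ∉ Λ₁(f)` for `3 ∤ n` (`zsmul_cuspSymbol_gammaTwo_not_mem_twentySeven`), while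
`3·{∞, γ₂∞}_f = {∞, γ₂³∞}_f ∈ Λ₁(f)` (`three_mul_cuspSymbol_gammaTwo_mem_twentySeven`: `d_{γ₂³} ≡ 8 ≡ −19` and
`19 = d_P` for the PARABOLIC `P = (−17 6; −54 19) ∈ Γ₀(27)` fixing the cusp `1/3`, whose period vanishes by the
landed `periodFunctional_eq_zero_of_conj_upper`). Hence the class of `{∞, γ₂∞}_f` in `Λ(f)/Λ₁(f)` has order EXACTLY
`3`, `Λ(f) ≠ Λ₁(f)`, and `¬ ShimuraIndexPrimeTo 3 f` (`not_shimuraIndexPrimeTo_three_twentySeven`) — E15 row `27a1`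
(index `3`, `snf [3,1]`) as a theorem for all `f ≠ 0`.

References: [LingOesterle1991] Thm. 1 and §1; [Mazur1977] §II.11; [Stevens1982] Ch. 1; [Manin1972] Thm. 1.6,
Thm. 1.9; [CremonaAlgorithms1997] §2.1–2.2.
-/

set_option autoImplicit false

noncomputable section

-- justification: the `Summit.BirchSwinnertonDyer.BirchSwinnertonDyer.…` path repeats a component (route-file convention)
set_option linter.dupNamespace false

open scoped Classical MatrixGroups

open CongruenceSubgroup Matrix.SpecialLinearGroup ModularGroup
open Literature.NumberTheory.EllipticCurves.ModularForms
open Summit.BirchSwinnertonDyer.BirchSwinnertonDyer.Theorems.ThetaLayerLambdaCongruenceAtTwo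
open Summit.BirchSwinnertonDyer.Rank1Residual.ManinAdditive.KatoCurve (ShimuraIndexPrimeTo)

namespace Summit.BirchSwinnertonDyer.BirchSwinnertonDyer.Theorems.ManinLocalTwoThree.ShimuraThree
/-! ## §3. The integral lift `M̃` of the cubic Shimura Manin system -/

/-- Lift table on the cosets `(c : d)` with `3 ∤ d`, indexed by `c d⁻¹ ∈ ℤ/27`. [folklore] -/
def liftA (x : ZMod 27) : ℤ :=
  match x.val with
  | 2 => 1 | 4 => -1 | 5 => -1 | 6 => -2 | 7 => -2 | 11 => -2 | 12 => -1 | 13 => -1 | 14 => -1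
  | 15 => -1 | 16 => 1 | 20 => 1 | 21 => 1 | 22 => 2 | 23 => 2 | 25 => 1
  | _ => 0

/-- Lift table on the cosets `(c : d)` with `3 ∣ d` (so `3 ∤ c`), indexed by `d c⁻¹ ∈ 3ℤ/27`. [folklore] -/
def liftB (x : ZMod 27) : ℤ :=
  match x.val with
  | 6 => -1 | 12 => 1 | 15 => 1 | 21 => 2
  | _ => 0

/-- **The integral Manin system** on bottom rows `(c, d)` mod `27` (a function on `P¹(ℤ/27) = Γ₀(27)\SL₂(ℤ)`; `0` on
the imprimitive pairs, which never occur). [folklore] -/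
def rowFun (c d : ZMod 27) : ℤ :=
  if c.val % 3 = 0 ∧ d.val % 3 = 0 then 0 else if d.val % 3 = 0 then liftB (d * inv27 c) else liftA (c * inv27 d)

/-- Sign invariance of `M̃`. [folklore] -/
theorem rowFun_neg (c d : ZMod 27) : rowFun (-c) (-d) = rowFun c d := by
  revert c d; decide

/-- **Two-term relation over `ℤ`**: `M̃(hS) = −M̃(h)` (`(c, d) ↦ (d, −c)`). [folklore] -/
theorem rowFun_S (c d : ZMod 27) : rowFun d (-c) = -rowFun c d := by
  revert c d; decide

/-- **Three-term relation over `ℤ`**: `M̃(h) + M̃(hτ) + M̃(hτ²) = 0`, `τ = S T⁻¹` (`(c, d) ↦ (d, −c−d) ↦ (−c−d, c)`).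
[folklore] -/
theorem rowFun_three_term (c d : ZMod 27) : rowFun c d + rowFun d (-c - d) + rowFun (-c - d) c = 0 := by
  revert c d; decide

/-- `M̃` is constant on `Γ₀(27)`-cosets: scaling the bottom row by a unit. [folklore] -/
theorem rowFun_smul (a e c d : ZMod 27) (hae : a * e = 1) : rowFun (e * c) (e * d) = rowFun c d := by
  obtain ⟨rfl, he⟩ := eq_inv27_of_mul_eq_one a e hae
  have hce := mul_val_mod_three e c he
  have hde := mul_val_mod_three e d he
  have k1 : e * d * inv27 (e * c) = d * inv27 c := by
    rw [inv27_mul]; linear_combination (d * inv27 c) * mul_inv27 e he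
  have k2 : e * c * inv27 (e * d) = c * inv27 d := by
    rw [inv27_mul]; linear_combination (c * inv27 d) * mul_inv27 e he
  simp only [rowFun, hce, hde, k1, k2]

/-- **`M̃` reduces to the Shimura Manin system mod `3`** — coset `(c : d)` with `3 ∤ d`, base point `(d⁻¹ 0; c d)`.
[folklore] -/
theorem rowFun_cast_of_unit (c d : ZMod 27) (hd : d.val % 3 ≠ 0) :
    ((rowFun c d : ℤ) : ZMod 3) = colFun (inv27 d) c - colFun 0 d := by
  revert c d; decide

/-- **`M̃` reduces to the Shimura Manin system mod `3`** — coset `(c : d)` with `3 ∣ d`, base point `(0 −c⁻¹; c d)`.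
[folklore] -/
theorem rowFun_cast_of_not_unit (c d : ZMod 27) (hd : d.val % 3 = 0) (hc : c.val % 3 ≠ 0) :
    ((rowFun c d : ℤ) : ZMod 3) = colFun 0 c - colFun (-inv27 c) d := by
  revert c d; decide

/-- **The integral Manin system on `SL₂(ℤ)`**: `M̃(h) = rowFun(h₁₀, h₁₁)`. [folklore] -/
def maninInt (h : SL(2, ℤ)) : ℤ := rowFun (((h 1 0 : ℤ) : ZMod 27)) (((h 1 1 : ℤ) : ZMod 27))

/-- `maninInt` only sees the bottom row. [folklore] -/
theorem maninInt_congr {g h : SL(2, ℤ)} (h0 : g 1 0 = h 1 0) (h1 : g 1 1 = h 1 1) : maninInt g = maninInt h := by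
  simp only [maninInt, h0, h1]

/-- Left `Γ₀(27)`-invariance. [folklore] -/
theorem maninInt_inv (δ : Gamma0 27) (h : SL(2, ℤ)) : maninInt ((δ : SL(2, ℤ)) * h) = maninInt h := by
  obtain ⟨hc, had⟩ := gamma0_entries δ
  have e0 : (((((δ : SL(2, ℤ)) * h) 1 0 : ℤ) : ZMod 27)) =
      ((((δ : SL(2, ℤ)) 1 1 : ℤ) : ZMod 27)) * (((h 1 0 : ℤ) : ZMod 27)) := by
    rw [_root_.Summit.BirchSwinnertonDyer.Rank2.LevelFifteen.sl_mul_apply']; push_cast; rw [hc, zero_mul, zero_add]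
  have e1 : (((((δ : SL(2, ℤ)) * h) 1 1 : ℤ) : ZMod 27)) =
      ((((δ : SL(2, ℤ)) 1 1 : ℤ) : ZMod 27)) * (((h 1 1 : ℤ) : ZMod 27)) := by
    rw [_root_.Summit.BirchSwinnertonDyer.Rank2.LevelFifteen.sl_mul_apply']; push_cast; rw [hc, zero_mul, zero_add]
  rw [maninInt, e0, e1, maninInt]
  exact rowFun_smul _ _ _ _ had

/-- Sign invariance. [folklore] -/
theorem maninInt_neg (h : SL(2, ℤ)) : maninInt (-h) = maninInt h := by
  have e0 : (-h) 1 0 = -h 1 0 := by simp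
  have e1 : (-h) 1 1 = -h 1 1 := by simp
  simp only [maninInt, e0, e1, Int.cast_neg, rowFun_neg]

/-- Two-term relation `M̃(hS) = −M̃(h)`. [folklore] -/
theorem maninInt_S (h : SL(2, ℤ)) : maninInt (h * S) = -maninInt h := by
  have s00 : (S : SL(2, ℤ)) 0 0 = 0 := rfl
  have s10 : (S : SL(2, ℤ)) 1 0 = 1 := rfl
  have s01 : (S : SL(2, ℤ)) 0 1 = -1 := rfl
  have s11 : (S : SL(2, ℤ)) 1 1 = 0 := rfl
  have e0 : (h * S) 1 0 = h 1 1 := by rw [_root_.Summit.BirchSwinnertonDyer.Rank2.LevelFifteen.sl_mul_apply', s00, s10]; ring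
  have e1 : (h * S) 1 1 = -h 1 0 := by rw [_root_.Summit.BirchSwinnertonDyer.Rank2.LevelFifteen.sl_mul_apply', s01, s11]; ring
  rw [maninInt, e0, e1, Int.cast_neg, rowFun_S, maninInt]

/-- Three-term relation `M̃(h) + M̃(hτ) + M̃(hτ²) = 0`, `τ = S T⁻¹`. [folklore] -/
theorem maninInt_three_term (h : SL(2, ℤ)) :
    maninInt h + maninInt (h * (S * T⁻¹)) + maninInt (h * (S * T⁻¹) * (S * T⁻¹)) = 0 := by
  rw [_root_.Summit.BirchSwinnertonDyer.BirchSwinnertonDyer.Theorems.ThetaLayerLambdaCongruenceAtTwo.S_mul_T_inv_eq]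
  set τ : SL(2, ℤ) := ⟨!![0, -1; 1, -1], by norm_num [Matrix.det_fin_two_of]⟩ with hτ
  have t00 : τ 0 0 = 0 := rfl
  have t10 : τ 1 0 = 1 := rfl
  have t01 : τ 0 1 = -1 := rfl
  have t11 : τ 1 1 = -1 := rfl
  have e10 : (h * τ) 1 0 = h 1 1 := by rw [_root_.Summit.BirchSwinnertonDyer.Rank2.LevelFifteen.sl_mul_apply', t00, t10]; ring
  have e11 : (h * τ) 1 1 = -h 1 0 - h 1 1 := by rw [_root_.Summit.BirchSwinnertonDyer.Rank2.LevelFifteen.sl_mul_apply', t01, t11]; ring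
  have f10 : (h * τ * τ) 1 0 = -h 1 0 - h 1 1 := by rw [_root_.Summit.BirchSwinnertonDyer.Rank2.LevelFifteen.sl_mul_apply', e10, e11, t00, t10]; ring
  have f11 : (h * τ * τ) 1 1 = h 1 0 := by rw [_root_.Summit.BirchSwinnertonDyer.Rank2.LevelFifteen.sl_mul_apply', e10, e11, t01, t11]; ring
  simp only [maninInt, e10, e11, f10, f11, Int.cast_sub, Int.cast_neg]
  exact rowFun_three_term _ _

/-- Vanishing on `S`-fixed cosets: `δh = hS` ⇒ `M̃(h) = −M̃(h)` ⇒ `M̃(h) = 0` in `ℤ`. [folklore] -/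
theorem maninInt_sigma_fixed (δ : Gamma0 27) (h : SL(2, ℤ)) (hfix : (δ : SL(2, ℤ)) * h = h * S) :
    maninInt h = 0 := by
  have e : maninInt h = -maninInt h := by
    rw [← maninInt_S, ← hfix, maninInt_inv]
  omega

/-- **`M̃ ≡ MS_χ (mod 3)`**: `maninInt h` reduces to `cuspFun h − cuspFun (hS)` for every `h ∈ SL₂(ℤ)`. (Left-multiply by
the upper unipotent `(1 −t; 0 1) ∈ Γ₀(27)` — which changes neither side — to move the top row to the base point of the
coset.) [folklore] -/
theorem maninInt_cast (h : SL(2, ℤ)) : ((maninInt h : ℤ) : ZMod 3) = cuspFun h - cuspFun (h * S) := by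
  -- the unipotent normalisation
  have key : ∀ t : ℤ, cuspFun h - cuspFun (h * S) =
      colFun ((((h 0 0 - t * h 1 0 : ℤ)) : ZMod 27)) (((h 1 0 : ℤ) : ZMod 27)) -
        colFun ((((h 0 1 - t * h 1 1 : ℤ)) : ZMod 27)) (((h 1 1 : ℤ) : ZMod 27)) := by
    intro t
    let u : SL(2, ℤ) := ⟨!![1, -t; 0, 1], by norm_num [Matrix.det_fin_two_of]⟩
    have u00 : u 0 0 = 1 := rfl
    have u01 : u 0 1 = -t := rfl
    have u10 : u 1 0 = 0 := rfl
    have u11 : u 1 1 = 1 := rfl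
    have hu : u ∈ Gamma0 27 := by rw [Gamma0_mem, u10, Int.cast_zero]
    have s00 : (S : SL(2, ℤ)) 0 0 = 0 := rfl
    have s10 : (S : SL(2, ℤ)) 1 0 = 1 := rfl
    have inv := cuspFun_gamma0_mul ⟨u, hu⟩
    simp only [u11, Int.cast_one, chi27_one, add_zero] at inv
    rw [← inv h, ← inv (h * S), ← mul_assoc]
    have a0 : (u * h) 0 0 = h 0 0 - t * h 1 0 := by rw [_root_.Summit.BirchSwinnertonDyer.Rank2.LevelFifteen.sl_mul_apply', u00, u01]; ring
    have a1 : (u * h) 1 0 = h 1 0 := by rw [_root_.Summit.BirchSwinnertonDyer.Rank2.LevelFifteen.sl_mul_apply', u10, u11]; ring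
    have b0 : (u * h * S) 0 0 = h 0 1 - t * h 1 1 := by
      simp only [_root_.Summit.BirchSwinnertonDyer.Rank2.LevelFifteen.sl_mul_apply', u00, u01, s00, s10]; ring
    have b1 : (u * h * S) 1 0 = h 1 1 := by
      simp only [_root_.Summit.BirchSwinnertonDyer.Rank2.LevelFifteen.sl_mul_apply', u10, u11, s00, s10]; ring
    simp only [cuspFun, a0, a1, b0, b1]
  set a : ZMod 27 := ((h 0 0 : ℤ) : ZMod 27) with ha
  set b : ZMod 27 := ((h 0 1 : ℤ) : ZMod 27) with hb
  set c : ZMod 27 := ((h 1 0 : ℤ) : ZMod 27) with hc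
  set d : ZMod 27 := ((h 1 1 : ℤ) : ZMod 27) with hd
  have hdet : a * d - b * c = 1 := by
    have := congrArg (Int.cast : ℤ → ZMod 27) (_root_.Summit.BirchSwinnertonDyer.BirchSwinnertonDyer.Theorems.ManinLocalTwoThree.ShimuraClass.sl_det h)
    push_cast at this
    rw [← ha, ← hb, ← hc, ← hd] at this
    exact this
  -- the unit case `3 ∤ d`: `t = b d⁻¹` moves the top row to `(d⁻¹, 0)`
  have unit_case : d.val % 3 ≠ 0 → ((maninInt h : ℤ) : ZMod 3) = cuspFun h - cuspFun (h * S) := by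
    intro hdu
    have hdi := mul_inv27 d hdu
    set t : ZMod 27 := b * inv27 d with ht
    have e := key (t.val : ℤ)
    have htc : ((t.val : ℕ) : ZMod 27) = t := ZMod.natCast_zmod_val t
    have g1 : a - t * c = inv27 d := by rw [ht]; linear_combination (inv27 d) * hdet - a * hdi
    have g2 : b - t * d = 0 := by rw [ht]; linear_combination (-b) * hdi
    rw [e, maninInt, ← hc, ← hd]
    push_cast
    rw [htc, ← ha, ← hb, ← hc, ← hd, g1, g2, rowFun_cast_of_unit c d hdu]
  rcases (row_prim h).symm with hdu | hcu
  · exact unit_case hdu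
  · by_cases hdu : d.val % 3 ≠ 0
    · exact unit_case hdu
    · -- `3 ∣ d` (so `3 ∤ c`): `t = a c⁻¹` moves the top row to `(0, −c⁻¹)`
      rw [not_not] at hdu
      have hci := mul_inv27 c hcu
      set t : ZMod 27 := a * inv27 c with ht
      have e := key (t.val : ℤ)
      have htc : ((t.val : ℕ) : ZMod 27) = t := ZMod.natCast_zmod_val t
      have g1 : a - t * c = 0 := by rw [ht]; linear_combination (-a) * hci
      have g2 : b - t * d = -inv27 c := by rw [ht]; linear_combination (-b) * hci - (inv27 c) * hdet
      rw [e, maninInt, ← hc, ← hd]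
      push_cast
      rw [htc, ← ha, ← hb, ← hc, ← hd, g1, g2, rowFun_cast_of_not_unit c d hdu hcu]


end Summit.BirchSwinnertonDyer.BirchSwinnertonDyer.Theorems.ManinLocalTwoThree.ShimuraThree
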